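import Literature.NumberTheory.Automorphic.PiOfArtinRepStandardLTheoryGL2Proofs
import Literature.NumberTheory.Automorphic.TwistedHeckeTheoryGL2
import HarnessLib

/-!
# Gelbart's Prop. 4.1 (both unramified shadows) from the NAMED fact
# `JacquetLanglands1970_twistedHeckeTheoryGL2` (pure proofs)

Topic `Literature/NumberTheory/Automorphic`; proof file (theorems only: no definition, no named
fact, no instance), sibling of `Automorphic/PiOfArtinRepHeckeTheoryOnlyProofs` and
`Automorphic/PiOfArtinRepStandardLTheoryGL2Proofs`.

The displayed hypothesis `HT` of the accepted reduction
`frobSatakeCompatibleAt_of_isPiOfArtinRep_both_of_heckeTheoryGL2` (p116514) — Jacquet–Langlands'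
twisted Hecke theory of a cuspidal automorphic representation of `GL₂(𝔸_F)` (LNM 114, Thm. 11.1 /
Cor. 11.2 with Thm. 2.18, Props. 3.5, 3.6, 3.8 (i), Lemma 3.9) — is now the named Literature fact
`JacquetLanglands1970_twistedHeckeTheoryGL2` (`Automorphic/TwistedHeckeTheoryGL2`, verbatim `HT`).
This file restates the closures BY NAME, so that the two named facts of Gelbart 1997, Prop. 4.1,

* `frobSatakeCompatibleAt_of_isPiOfArtinRep_of_isUnramifiedAt` (σ-unramified shadow,
  `Automorphic/PiOfArtinRepAtSigmaUnramifiedPlaces`) and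
* `frobSatakeCompatibleAt_of_isPiOfArtinRep` (π-unramified shadow, `Automorphic/StrongArtinGL2`),

depend on exactly ONE tree-tracked object: when `JacquetLanglands1970_twistedHeckeTheoryGL2_holds`
lands, `frobSatakeCompatibleAt_of_isPiOfArtinRep_of_isUnramifiedAt_holds` is
`frobSatakeCompatibleAt_of_isPiOfArtinRep_of_isUnramifiedAt_of_JacquetLanglands1970_twistedHeckeTheoryGL2
JacquetLanglands1970_twistedHeckeTheoryGL2_holds` and likewise for the companion.

* `JacquetLanglands1970_twistedHeckeTheoryGL2.standardL` — Thm. 11.1 (untwisted) as the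
  specialisation of the named fact at the trivial character.
* `frobSatakeCompatibleAt_of_isPiOfArtinRep_of_isUnramifiedAt_of_JacquetLanglands1970_twistedHeckeTheoryGL2`,
  `frobSatakeCompatibleAt_of_isPiOfArtinRep_of_JacquetLanglands1970_twistedHeckeTheoryGL2`,
  `frobSatakeCompatibleAt_of_isPiOfArtinRep_both_of_JacquetLanglands1970_twistedHeckeTheoryGL2` —
  the named fact implies both shadows (Jacquet–Langlands' proof of Thm. 12.2, pp. 209–211, all of
  whose other ingredients — Artin's functional equation, the quotient of functional equations,
  local rigidity at `v`, the auxiliary characters of Lemma 12.5 / Langlands' *Base change* §3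
  Lemma 3.2 via class field theory and Chevalley's congruence theorem for the `{v}`-units — are
  theorems of the tree: `PiOfArtinRepAtSigmaUnramifiedPlaces{Proofs,ArtinSideProofs,HeckeTheoryProofs}`,
  `PiOfArtinRepTwistEulerFactorProofs`, `PiOfArtinRepAuxiliaryCharactersProofs`,
  `PiOfArtinRepChevalley{Lemmas,}Proofs`, `NumberFields/ChevalleyVUnitCongruenceProofs`,
  `PiOfArtinRepHeckeTheoryOnlyProofs`).
* `JacquetLanglands1970_twistedHeckeTheoryGL2_of_standardLTheoryGL2` — the named fact from the
  purely automorphic standard `L`-function theory `HL` of cuspidal `GL(2)` with internal Hecke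
  twists (the displayed hypothesis of `twistedHeckeTheoryGL2_of_standardLTheoryGL2`, p120960:
  class field theory for characters and their powers, Satake parameters of twists).

## References

* H. Jacquet, R. P. Langlands, *Automorphic Forms on GL(2)*, LNM 114 (1970), Thm. 11.1, Cor. 11.2,
  Thm. 2.18, Props. 3.5, 3.6, 3.8, Lemma 3.9, Lemma 12.5, Thm. 12.2. [JacquetLanglands1970]
* S. Gelbart, *Three lectures on the modularity of ρ̄_{E,3} and the Langlands reciprocity
  conjecture*, in Modular Forms and Fermat's Last Theorem (1997), Prop. 4.1, Thm. 3.2,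
  Example 3.2.3. [Gelbart1997]
* R. P. Langlands, *Base change for GL(2)*, Ann. of Math. Stud. 96 (1980), §3, Lemma 3.2 and
  pp. 23–24. [LanglandsBaseChange1980]
-/

noncomputable section

open scoped NumberField Polynomial
open NumberField IsDedekindDomain Field Polynomial
open Literature.NumberTheory.GaloisRepresentations (HeckeCharacter)

namespace Literature.NumberTheory.Automorphic

/-! ### Theorem 11.1 (untwisted) from the named fact -/

/-- **Theorem 11.1 as the untwisted case of the package.**  Specialising
`JacquetLanglands1970_twistedHeckeTheoryGL2` at the trivial character: for a cuspidal `π` on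
`GL₂(𝔸_F)` there are local Euler polynomials `P_u, P'_u` (`P(0) = 1`, `deg ≤ 2`) of `π` and `π̃`,
meromorphic `Λ, Λ'`, entire `Γ, Γ'` with zeros on finitely many horizontal lines, a continuous
nowhere-zero `ε` and `c ≥ 1` with `Λ Γ = ∏'_u P_u(q_u^{-s})⁻¹`, `Λ' Γ' = ∏'_u P'_u(q_u^{-s})⁻¹` on
`re s > c`, `Λ(s) = ε(s) Λ'(1 - s)`, the unramified factors `P_u = ∏_{a ∈ α}(1 - a X)`,
`P'_u = ∏_{a ∈ α}(1 - a⁻¹ X)` wherever `π` has Satake parameter `α`, and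
"`deg P_u = 2` ⇒ `π` has Satake parameter the inverse roots of `P_u` at `u`"
(Jacquet–Langlands 1970, Thm. 11.1 with Thm. 2.18, Props. 3.5, 3.6, Lemma 3.9).
[cite: JacquetLanglands1970, Thm. 11.1] -/
theorem JacquetLanglands1970_twistedHeckeTheoryGL2.standardL
    (h : JacquetLanglands1970_twistedHeckeTheoryGL2)
    {F : Type} [Field F] [NumberField F] (hcpt : isCompact_glFiniteIntegralLevel 2 F)
    (π : CuspidalAutomorphicRepData 2 F hcpt) :
    ∃ (P P' : HeightOneSpectrum (𝓞 F) → Polynomial ℂ) (Λ Λ' Γ Γ' ε : ℂ → ℂ) (c : ℝ),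
      (∀ u, (P u).eval 0 = 1 ∧ (P u).natDegree ≤ 2) ∧
      (∀ u, (P' u).eval 0 = 1 ∧ (P' u).natDegree ≤ 2) ∧
      Meromorphic Λ ∧ Meromorphic Λ' ∧ Differentiable ℂ Γ ∧ Differentiable ℂ Γ' ∧
      (∃ Y : Set ℝ, Y.Finite ∧ ∀ s, Γ s = 0 → s.im ∈ Y) ∧
      (∃ Y : Set ℝ, Y.Finite ∧ ∀ s, Γ' s = 0 → s.im ∈ Y) ∧
      Continuous ε ∧ (∀ s, ε s ≠ 0) ∧ 1 ≤ c ∧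
      (∀ s : ℂ, c < s.re →
        (Multipliable fun u : HeightOneSpectrum (𝓞 F) =>
            ((P u).eval ((u.residueCard : ℂ) ^ (-s)))⁻¹) ∧
          (∀ u, (P u).eval ((u.residueCard : ℂ) ^ (-s)) ≠ 0) ∧
          Λ s * Γ s =
            ∏' u : HeightOneSpectrum (𝓞 F), ((P u).eval ((u.residueCard : ℂ) ^ (-s)))⁻¹) ∧
      (∀ s : ℂ, c < s.re →
        (Multipliable fun u : HeightOneSpectrum (𝓞 F) =>
            ((P' u).eval ((u.residueCard : ℂ) ^ (-s)))⁻¹) ∧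
          (∀ u, (P' u).eval ((u.residueCard : ℂ) ^ (-s)) ≠ 0) ∧
          Λ' s * Γ' s =
            ∏' u : HeightOneSpectrum (𝓞 F), ((P' u).eval ((u.residueCard : ℂ) ^ (-s)))⁻¹) ∧
      (∀ s, Λ s = ε s * Λ' (1 - s)) ∧
      (∀ (u : HeightOneSpectrum (𝓞 F)) (α : Multiset ℂ), π.1.HasSatakeParamAt u α →
        P u = eulerPolynomial α ∧ P' u = eulerPolynomial (α.map fun a => a⁻¹)) ∧
      (∀ u : HeightOneSpectrum (𝓞 F), (P u).natDegree = 2 →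
        ∃ B : Multiset ℂ, (0 : ℂ) ∉ B ∧ P u = eulerPolynomial B ∧ π.1.HasSatakeParamAt u B) := by
  obtain ⟨Nπ, hN⟩ := h hcpt π
  obtain ⟨P, P', Λ, Λ', Γ, Γ', ε, c, hP, hP', hΛ, hΛ', hΓ, hΓ', hY, hY', hε, hε0, hc, hE, hE',
    hFE, hunr, -, -, hdeg⟩ := hN 1
  refine ⟨P, P', Λ, Λ', Γ, Γ', ε, c, hP, hP', hΛ, hΛ', hΓ, hΓ', hY, hY', hε, hε0, hc, hE, hE',
    hFE, fun u α hα => ?_, fun u hu => ?_⟩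
  · -- the trivial character is unramified everywhere with `χ(Frob_u) = 1`
    obtain ⟨𝔓, h𝔓⟩ := HeightOneSpectrum.primesAbove_nonempty u
    obtain ⟨g, hg⟩ := HeightOneSpectrum.exists_isArithFrobAt_of_mem_primesAbove_holds h𝔓
    have h1 := hunr u α hα (fun _ _ _ _ => rfl) 𝔓 h𝔓 g hg
    simpa using h1
  · exact hdeg u (fun _ _ _ _ => rfl) (fun _ _ _ _ => rfl) hu

/-! ### Both shadows of Gelbart's Prop. 4.1 from the named fact -/

/-- **Gelbart's Prop. 4.1, σ-unramified shadow, from the named fact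
`JacquetLanglands1970_twistedHeckeTheoryGL2`.** `JacquetLanglands1970_twistedHeckeTheoryGL2 →
frobSatakeCompatibleAt_of_isPiOfArtinRep_of_isUnramifiedAt`, by
`frobSatakeCompatibleAt_of_isPiOfArtinRep_of_isUnramifiedAt_of_heckeTheoryGL2`
(`PiOfArtinRepHeckeTheoryOnlyProofs`), whose displayed hypothesis `HT` the named fact restates
verbatim (the `fun hcpt π => …` η-expansion unfolds the definition).  When
`JacquetLanglands1970_twistedHeckeTheoryGL2_holds` lands,
`frobSatakeCompatibleAt_of_isPiOfArtinRep_of_isUnramifiedAt_holds` is this theorem applied to it.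
[cite: Gelbart1997, Prop. 4.1 (with Thm. 3.2 and Example 3.2.3)]
[cite: LanglandsBaseChange1980, §3, Lemma 3.2 and pp. 23–24]
[cite: JacquetLanglands1970, Lemma 12.5 and the proof of Thm. 12.2, pp. 209–211] -/
theorem frobSatakeCompatibleAt_of_isPiOfArtinRep_of_isUnramifiedAt_of_JacquetLanglands1970_twistedHeckeTheoryGL2
    (h : JacquetLanglands1970_twistedHeckeTheoryGL2) :
    frobSatakeCompatibleAt_of_isPiOfArtinRep_of_isUnramifiedAt :=
  frobSatakeCompatibleAt_of_isPiOfArtinRep_of_isUnramifiedAt_of_heckeTheoryGL2 (fun hcpt π => h hcpt π)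

/-- **Gelbart's Prop. 4.1, π-unramified shadow (`frobSatakeCompatibleAt_of_isPiOfArtinRep` of
`Automorphic/StrongArtinGL2`), from the named fact `JacquetLanglands1970_twistedHeckeTheoryGL2`**,
by `frobSatakeCompatibleAt_of_isPiOfArtinRep_of_heckeTheoryGL2` (`PiOfArtinRepHeckeTheoryOnlyProofs`).
Hence one discharge of `JacquetLanglands1970_twistedHeckeTheoryGL2` closes both facts of Gelbart's
Prop. 4.1 (and subsumes the companion's split child `JacquetLanglands1970_twistedCuspidalPackage`
of `StrongArtinGL2OfAutomorphicHalf`). [cite: Gelbart1997, Prop. 4.1]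
[cite: JacquetLanglands1970, Lemma 12.5 and the proof of Thm. 12.2, pp. 209–211] -/
theorem frobSatakeCompatibleAt_of_isPiOfArtinRep_of_JacquetLanglands1970_twistedHeckeTheoryGL2
    (h : JacquetLanglands1970_twistedHeckeTheoryGL2) :
    frobSatakeCompatibleAt_of_isPiOfArtinRep :=
  frobSatakeCompatibleAt_of_isPiOfArtinRep_of_heckeTheoryGL2 (fun hcpt π => h hcpt π)

/-- Both shadows of Gelbart's Prop. 4.1 at once from the named fact (the conjunction proved by
`frobSatakeCompatibleAt_of_isPiOfArtinRep_both_of_heckeTheoryGL2`). [cite: Gelbart1997, Prop. 4.1]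
[cite: JacquetLanglands1970, proof of Thm. 12.2, pp. 209–211] -/
theorem frobSatakeCompatibleAt_of_isPiOfArtinRep_both_of_JacquetLanglands1970_twistedHeckeTheoryGL2
    (h : JacquetLanglands1970_twistedHeckeTheoryGL2) :
    frobSatakeCompatibleAt_of_isPiOfArtinRep ∧
      frobSatakeCompatibleAt_of_isPiOfArtinRep_of_isUnramifiedAt :=
  frobSatakeCompatibleAt_of_isPiOfArtinRep_both_of_heckeTheoryGL2 (fun hcpt π => h hcpt π)

/-! ### The named fact from the purely automorphic standard `L`-function theory `HL` -/

/-- **`HL ⟹ JacquetLanglands1970_twistedHeckeTheoryGL2`.**  The named fact (Jacquet–Langlands'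
twisted Hecke theory in Galois-indexed form) from the standard `L`-function theory of cuspidal
`GL(2)` with honest local factors at all finite places and internal finite-order Hecke twists
(`HL`: Jacquet–Langlands 1970, Thm. 11.1, Cor. 11.2, Thm. 2.18, Props. 3.5, 3.6, 3.8 (i), Lemma 3.9,
with the Borel–Jacquet / Flath unramified dictionary), by
`twistedHeckeTheoryGL2_of_standardLTheoryGL2` (`PiOfArtinRepStandardLTheoryGL2Proofs`: Artin
reciprocity for characters and their powers, Satake parameters of twists, twisting back).
[cite: JacquetLanglands1970, Thm. 11.1, Cor. 11.2, Thm. 2.18, Props. 3.5, 3.6, 3.8, Lemma 3.9]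
[cite: CasselsFrohlichANT1967, Ch. VII §5.1 Main Theorem (A)] -/
theorem JacquetLanglands1970_twistedHeckeTheoryGL2_of_standardLTheoryGL2
    (HL : ∀ {F : Type} [Field F] [NumberField F] (hcpt : isCompact_glFiniteIntegralLevel 2 F),
      ∃ L L' : CuspidalAutomorphicRepData 2 F hcpt → HeightOneSpectrum (𝓞 F) → ℂ[X],
        (∀ (π : CuspidalAutomorphicRepData 2 F hcpt) (u : HeightOneSpectrum (𝓞 F)),
          (L π u).eval 0 = 1 ∧ (L π u).natDegree ≤ 2 ∧
            (L' π u).eval 0 = 1 ∧ (L' π u).natDegree ≤ 2) ∧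
        (∀ π : CuspidalAutomorphicRepData 2 F hcpt, ∃ (Λ Λ' Γ Γ' ε : ℂ → ℂ) (c : ℝ),
          Meromorphic Λ ∧ Meromorphic Λ' ∧ Differentiable ℂ Γ ∧ Differentiable ℂ Γ' ∧
          (∃ Y : Set ℝ, Y.Finite ∧ ∀ s, Γ s = 0 → s.im ∈ Y) ∧
          (∃ Y : Set ℝ, Y.Finite ∧ ∀ s, Γ' s = 0 → s.im ∈ Y) ∧
          Continuous ε ∧ (∀ s, ε s ≠ 0) ∧ 1 ≤ c ∧
          (∀ s : ℂ, c < s.re →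
            (Multipliable fun u : HeightOneSpectrum (𝓞 F) =>
                ((L π u).eval ((u.residueCard : ℂ) ^ (-s)))⁻¹) ∧
              (∀ u, (L π u).eval ((u.residueCard : ℂ) ^ (-s)) ≠ 0) ∧
              Λ s * Γ s =
                ∏' u : HeightOneSpectrum (𝓞 F), ((L π u).eval ((u.residueCard : ℂ) ^ (-s)))⁻¹) ∧
          (∀ s : ℂ, c < s.re →
            (Multipliable fun u : HeightOneSpectrum (𝓞 F) =>
                ((L' π u).eval ((u.residueCard : ℂ) ^ (-s)))⁻¹) ∧
              (∀ u, (L' π u).eval ((u.residueCard : ℂ) ^ (-s)) ≠ 0) ∧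
              Λ' s * Γ' s =
                ∏' u : HeightOneSpectrum (𝓞 F), ((L' π u).eval ((u.residueCard : ℂ) ^ (-s)))⁻¹) ∧
          (∀ s, Λ s = ε s * Λ' (1 - s))) ∧
        (∀ (π : CuspidalAutomorphicRepData 2 F hcpt) (u : HeightOneSpectrum (𝓞 F))
          (β : Multiset ℂ), π.1.HasSatakeParamAt u β →
            L π u = eulerPolynomial β ∧ L' π u = eulerPolynomial (β.map (·⁻¹))) ∧
        (∀ (π : CuspidalAutomorphicRepData 2 F hcpt) (ω : HeckeCharacter F)
          (hω : ω.IsFiniteOrder) (u : HeightOneSpectrum (𝓞 F)),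
          π.1.IsUnramifiedAt u → ¬ ω.IsUnramifiedAt u →
            L (π.twist ω hω) u = 1 ∧ L' (π.twist ω hω) u = 1) ∧
        (∀ π : CuspidalAutomorphicRepData 2 F hcpt, ∃ M : HeightOneSpectrum (𝓞 F) → ℕ,
          ∀ (ω : HeckeCharacter F) (hω : ω.IsFiniteOrder) (u : HeightOneSpectrum (𝓞 F)),
            (∀ k : ℕ, 0 < k → k ≤ M u → ¬ (ω ^ k).IsUnramifiedAt u) →
              L (π.twist ω hω) u = 1 ∧ L' (π.twist ω hω) u = 1) ∧
        (∀ (π : CuspidalAutomorphicRepData 2 F hcpt) (u : HeightOneSpectrum (𝓞 F)),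
          (L π u).natDegree = 2 →
            ∃ B : Multiset ℂ, (0 : ℂ) ∉ B ∧ L π u = eulerPolynomial B ∧
              π.1.HasSatakeParamAt u B)) :
    JacquetLanglands1970_twistedHeckeTheoryGL2 :=
  fun hcpt π => twistedHeckeTheoryGL2_of_standardLTheoryGL2 HL hcpt π

end Literature.NumberTheory.Automorphic

end
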